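import Summits.QuantumFields.YangMills.Theorems.CurvatureSandwichBound.Negative.Unbundled
import Summits.QuantumFields.YangMills.Theorems.DiagonalMirrorRPR.Negative.InfiniteCouplingSlice
import Summits.QuantumFields.YangMills.Theorems.PencilRigidityNPointIsotropySandwichVacuumRowOfKernelHelpers

/-!
# `CurvatureSandwichBound` (Σ) — negative-side support II: the inner quantifiers are inhabited; constant fields
satisfy both rows (`μ = 0`); the `β ≡ 0` slice cannot refute Σ

Support file for crux `stmt-QuantumFields-18372` (refuter, cdisprove), extracted from the work file
`Cruxes/CurvatureSandwichBound/Disproof.lean`.  Tree objects only; nothing is posited.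

* `norm_fieldVec_constField`: for the constant field `𝔖ₙ(F) = κⁿ ∫ F` (`DiagonalMirrorRPR.Negative.constField`, the
  law of the deterministic configuration `φ ≡ κ`; its OS space is the vacuum line) `‖Ψ_F‖ = |κ|ⁿ |∫ F|`.
* `sandwichBound_constField`, `sandwichRows_constField(_pullback)`: BOTH ROWS OF Σ HOLD for every constant field,
  in every frame, with `μ = 0` and `C = |κ|/2`: `‖Ψ_{f₁ ⊗ W_a}‖ = |κ| |∫ f₁| ‖Ψ_W‖` and
  `|∫ f₁| ≤ ∫|g| ∫|hh| ≤ Mg · Mh` (planar/transverse Tonelli).  MEANING for the crux: by the landed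
  `CurvatureBoostCovariance.Negative.tie_beta_zero_factorises`, a family tied to a scheme with `β_k = 0`
  frequently is a c-number field on off-diagonal real tensors — on paper `constField κ` on all of `⁰𝒮` (density of
  such tensors in `⁰𝒮`, continuity of `S₁ n`) — and the rows read `S₁` on `⁰𝒮` only (`norm_fieldVec_sq`): NO
  `β ≡ 0` SCHEME (whatever `c_k, m_k, a_k, L_k`, `r`, `G`) REFUTES Σ.  Together with `hypotheses_and_rows_vac` (the
  `c ≡ 0` slice) this exhausts the certified inhabitants of `W₁`.
* `osReconstruction_of_osPackage`, `osReconstruction_quarterTurn`: under the crux's hypotheses BOTH inner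
  quantifiers `∀ h`, `∀ R h'` of the conclusion are inhabited (E2 along `e₀`; diagonal RP from the eight frames,
  translations conjugated through `R`) — the rows are genuinely asserted, not vacuously.
* `osReconstruction_constField`: the `e₀`-reconstruction premises hold for constant fields (so the rows above are
  not vacuous for them either).
(The natural strengthenings — sup-norm-only constant, uniform constant — are refuted in support file III,
`SupNormOnlyFalse.lean`.)
-/

noncomputable section

namespace Summit.QuantumFields.YangMills.Theorems.CurvatureSandwichBound.Negative

open scoped BigOperators SchwartzMap ComplexConjugate InnerProductSpace ENNReal
open MeasureTheory Filter Topology Complex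
open Literature.MathematicalPhysics.QuantumLattice Literature.MathematicalPhysics.AQFT
  Literature.MathematicalPhysics.QuantumFieldTheory
open Summit.QuantumFields.YangMills.Theorems.NPointIsotropy.Negative (E4)
open Summit.QuantumFields.YangMills.Theorems.CurvatureBoostCovariance.Negative
  (OSPackage Translations EightFrameRP isOffDiagonal_linActMulti)
open Summit.QuantumFields.YangMills.Theorems.DiagonalMirrorRPR.Negative
  (integ integ_apply constField constField_apply integral_linActMulti integral_appendTensor integral_osAdjoint
    constField_pullback_isReflectionPositive)
open Summit.QuantumFields.YangMills.Theorems.NPointIsotropy.ComplexRotationBandlimit.SandwichVacuumRow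
  (exists_planarTransverseSplit lintegral_planar_mul_transverse)

/-! ## §0 The inner quantifiers of the conclusion are inhabited under the hypotheses -/

/-- Under `W₁` (E2 along `e₀` inside the OS package, translations on `⁰𝒮`) the `e₀`-reconstruction exists: the
first row of the conclusion is not vacuously quantified. [folklore] -/
theorem osReconstruction_of_osPackage {S₁ : SchwingerFamily E4} (hOS : OSPackage S₁) (hT : Translations S₁) :
    OSReconstructionNoE1 S₁.toLabelled :=
  ⟨hOS.2.2.2.1, fun n _ a F hF => hT n a F hF⟩

/-- Under the eight-frame RP and translations on `⁰𝒮`, the quarter-turn pull-back `S₁ ∘ R` admits the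
`e₀`-reconstruction (diagonal RP is one of the eight frames: `a = cos(π/4)`, `b = −sin(π/4)`, `a² = b²`;
translations conjugate through `R`): the second row is not vacuously quantified either. [folklore] -/
theorem osReconstruction_quarterTurn {S₁ : SchwingerFamily E4} (h8 : EightFrameRP S₁) (hT : Translations S₁)
    {R : E4 ≃ₗᵢ[ℝ] E4} (hR : IsQuarterTurnFrame R) :
    OSReconstructionNoE1 (SchwingerFamily.toLabelled fun n => (S₁ n).comp (linActMulti R)) := by
  refine ⟨h8 R (Real.cos (Real.pi / 4)) (-Real.sin (Real.pi / 4)) ?_ ?_ hR.apply_single_zero,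
    fun n _ a F hF => ?_⟩
  · rw [neg_sq, Real.cos_sq_add_sin_sq]
  · right; right
    rw [neg_sq, Real.cos_pi_div_four, Real.sin_pi_div_four]
  · show S₁ n (linActMulti R (translateMulti a F)) = S₁ n (linActMulti R F)
    rw [linActMulti_translateMulti]
    exact hT n (R a) _ (isOffDiagonal_linActMulti hF R)

/-! ## §1 Constant fields: integrals, reconstruction, norms of field vectors -/

variable {n : ℕ}

/-- Lebesgue measure on `(ℝ⁴)ⁿ` is invariant under diagonal translations: `∫ F(x − a) = ∫ F`. [folklore] -/
theorem integral_translateMulti (a : E4) (F : 𝓢((Fin n → E4), ℂ)) :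
    ∫ x, translateMulti a F x = ∫ x, F x := by
  have h : (fun x : Fin n → E4 => translateMulti a F x) = fun x => (fun y : Fin n → E4 => F y) (x - fun _ => a) := by
    funext x
    rw [translateMulti_apply]
    rfl
  rw [h]
  exact integral_sub_right_eq_self _ _

/-- Pulling a constant field back by a linear isometry gives the same family. [folklore] -/
theorem constField_pullback (κ : ℝ) (R : E4 ≃ₗᵢ[ℝ] E4) :
    (fun n => (constField κ n).comp (linActMulti R)) = constField κ := by
  funext n
  ext F
  rw [ContinuousLinearMap.comp_apply, constField_apply, constField_apply, integral_linActMulti]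

/-- **The `e₀`-reconstruction premises hold for constant fields** (E2 in the identity frame; translation
invariance on all of `𝓢`). [folklore] -/
theorem osReconstruction_constField (κ : ℝ) : OSReconstructionNoE1 (constField κ).toLabelled := by
  refine ⟨?_, fun n _ a F _ => ?_⟩
  · have h := constField_pullback_isReflectionPositive κ (LinearIsometryEquiv.refl ℝ E4)
    rwa [constField_pullback] at h
  · rw [SchwingerFamily.toLabelled_apply, constField_apply, constField_apply, integral_translateMulti]

/-- … and for their pull-backs by any frame. [folklore] -/
theorem osReconstruction_constField_pullback (κ : ℝ) (R : E4 ≃ₗᵢ[ℝ] E4) :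
    OSReconstructionNoE1 (SchwingerFamily.toLabelled fun n => (constField κ n).comp (linActMulti R)) := by
  rw [constField_pullback]
  exact osReconstruction_constField κ

/-- **`‖Ψ_F‖ = |κ|ⁿ |∫ F|`** for the constant field: `‖Ψ_F‖² = Re κ²ⁿ ∫(θF* ⊗ F) = κ²ⁿ |∫ F|²`. [folklore] -/
theorem norm_fieldVec_constField (κ : ℝ) (h : OSReconstructionNoE1 (constField κ).toLabelled)
    (F : 𝓢((Fin n → E4), ℂ)) (hF : IsTimeOrdered F) :
    ‖h.fieldVec n (fun _ => ()) F hF‖ = |κ| ^ n * ‖∫ x, F x‖ := by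
  have h2 := norm_fieldVec_sq h F hF
  rw [constField_apply, integral_appendTensor (isAppendTensorOf_appendTensor _ _), integral_osAdjoint,
    Complex.conj_mul'] at h2
  have h3 : (((κ : ℂ) ^ (n + n)) * ((‖∫ x, F x‖ : ℂ) ^ 2)).re = (|κ| ^ n * ‖∫ x, F x‖) ^ 2 := by
    have e : ((κ : ℂ) ^ (n + n)) * ((‖∫ x, F x‖ : ℂ) ^ 2) = ((κ ^ (n + n) * ‖∫ x, F x‖ ^ 2 : ℝ) : ℂ) := by
      push_cast; ring
    rw [e, Complex.ofReal_re, mul_pow, ← pow_mul, show n * 2 = n + n by ring, Even.pow_abs ⟨n, rfl⟩]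
  rw [h3] at h2
  exact (sq_eq_sq₀ (norm_nonneg _) (by positivity)).1 h2

/-! ## §2 The planar/transverse product estimate `|∫ f₁| ≤ ∫|g| · ∫|hh|` -/

/-- **`∫_{(ℝ⁴)¹} |g(x⁰,x¹) hh(x²,x³)| = ∫|g| · ∫|hh|`** (as extended integrals): `(ℝ⁴)¹ ≅ ℝ⁴ ≅ ℝ² × ℝ²` and Tonelli.
[folklore] -/
theorem lintegral_enorm_of_factorises {f₁ : 𝓢((Fin 1 → E4), ℂ)} {g hh : ℝ × ℝ → ℂ}
    (hf₁ : ∀ x : Fin 1 → E4, f₁ x = g (x 0 0, x 0 1) * hh (x 0 2, x 0 3))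
    (hg : AEStronglyMeasurable g) (hhh : AEStronglyMeasurable hh) :
    ∫⁻ x : Fin 1 → E4, ‖f₁ x‖ₑ = (∫⁻ p, ‖g p‖ₑ) * ∫⁻ q, ‖hh q‖ₑ := by
  have h1 : ∫⁻ x : Fin 1 → E4, ‖f₁ x‖ₑ = ∫⁻ y : E4, ‖g (y 0, y 1)‖ₑ * ‖hh (y 2, y 3)‖ₑ := by
    rw [← (volume_preserving_funUnique (Fin 1) E4).lintegral_comp_emb
      (MeasurableEquiv.funUnique (Fin 1) E4).measurableEmbedding]
    refine lintegral_congr fun x => ?_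
    rw [hf₁ x, enorm_mul]
    rfl
  rw [h1]
  exact lintegral_planar_mul_transverse (fun p => ‖g p‖ₑ) (fun q => ‖hh q‖ₑ) hg.enorm hhh.enorm

/-- **`|∫ f₁| ≤ Mg · Mh`** for `f₁ = g ⊗ hh` with `∫|g| ≤ Mg`, `∫|hh| ≤ Mh`. [folklore] -/
theorem norm_integral_le_of_factorises {f₁ : 𝓢((Fin 1 → E4), ℂ)} {g hh : ℝ × ℝ → ℂ} {Mg Mh : ℝ}
    (hf₁ : ∀ x : Fin 1 → E4, f₁ x = g (x 0 0, x 0 1) * hh (x 0 2, x 0 3))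
    (hg : Integrable g) (hgM : (∫ p, ‖g p‖) ≤ Mg) (hhh : Integrable hh) (hhM : (∫ p, ‖hh p‖) ≤ Mh) :
    ‖∫ x, f₁ x‖ ≤ Mg * Mh := by
  have hg0 : 0 ≤ ∫ p, ‖g p‖ := integral_nonneg fun _ => norm_nonneg _
  have hh0 : 0 ≤ ∫ p, ‖hh p‖ := integral_nonneg fun _ => norm_nonneg _
  calc ‖∫ x, f₁ x‖ ≤ ∫ x, ‖f₁ x‖ := norm_integral_le_integral_norm _
    _ = (∫⁻ x, ‖f₁ x‖ₑ).toReal := integral_norm_eq_lintegral_enorm f₁.integrable.aestronglyMeasurable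
    _ = (∫ p, ‖g p‖) * ∫ q, ‖hh q‖ := by
        rw [lintegral_enorm_of_factorises hf₁ hg.aestronglyMeasurable hhh.aestronglyMeasurable,
          ← ofReal_integral_norm_eq_lintegral_enorm hg, ← ofReal_integral_norm_eq_lintegral_enorm hhh,
          ENNReal.toReal_mul, ENNReal.toReal_ofReal hg0, ENNReal.toReal_ofReal hh0]
    _ ≤ Mg * Mh := mul_le_mul hgM hhM hh0 (hg0.trans hgM)

/-! ## §3 Both rows of Σ hold for constant fields, `μ = 0`, `C = |κ|/2` -/

/-- **The sandwich bound for the constant field `κ`** with `μ = 0`, `C = |κ|/2` (every `e₀`-reconstruction):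
`‖Ψ_{f₁ ⊗ W_a}‖ = |κ|^{1+n} |∫ f₁| |∫ W| ≤ |κ| Mg (Mh + Mh') · |κ|ⁿ |∫ W|`. [folklore] -/
theorem sandwichBound_constField (κ : ℝ) (h : OSReconstructionNoE1 (constField κ).toLabelled) :
    SandwichBound (constField κ) h 0 (|κ| / 2) := by
  intro u v _ _ _ _ f₁ g hh Mg Mh Mh' hf₁ _ hg hgM hhh hhM hhM' n W hW hFW
  rw [norm_fieldVec_constField, norm_fieldVec_constField,
    integral_appendTensor (isAppendTensorOf_appendTensor _ _), integral_translateMulti, norm_mul, neg_zero,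
    Real.rpow_zero, Real.rpow_zero]
  have hMg : 0 ≤ Mg := le_trans (integral_nonneg fun _ => norm_nonneg _) hgM
  have hMh' : 0 ≤ Mh' := le_trans (norm_nonneg _) (hhM' 0)
  have hkey : ‖∫ x, f₁ x‖ ≤ Mg * (Mh + Mh') :=
    (norm_integral_le_of_factorises hf₁ hg hgM hhh hhM).trans (by nlinarith)
  calc |κ| ^ (1 + n) * (‖∫ x, f₁ x‖ * ‖∫ x, W x‖)
      = (|κ| ^ n * ‖∫ x, W x‖) * (|κ| * ‖∫ x, f₁ x‖) := by ring
    _ ≤ (|κ| ^ n * ‖∫ x, W x‖) * (|κ| * (Mg * (Mh + Mh'))) := by gcongr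
    _ = |κ| / 2 * Mg * (Mh + Mh') * (1 + 1) * (|κ| ^ n * ‖∫ x, W x‖) := by ring

/-- **Both rows of Σ hold for every constant field** (`μ = 0 < 4`). [folklore] -/
theorem sandwichRows_constField (κ : ℝ) : SandwichRows (constField κ) :=
  fun h => ⟨0, |κ| / 2, by norm_num, sandwichBound_constField κ h⟩

/-- … in every frame, in particular the quarter-turn frame of the second row. [folklore] -/
theorem sandwichRows_constField_pullback (κ : ℝ) (R : E4 ≃ₗᵢ[ℝ] E4) :
    SandwichRows (fun n => (constField κ n).comp (linActMulti R)) := by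
  rw [constField_pullback]
  exact sandwichRows_constField κ

/-- **The conclusion of Σ (both conjuncts) for constant fields.** [folklore] -/
theorem conclusion_constField (κ : ℝ) :
    SandwichRows (constField κ) ∧
      ∀ R : E4 ≃ₗᵢ[ℝ] E4, IsQuarterTurnFrame R → SandwichRows (fun n => (constField κ n).comp (linActMulti R)) :=
  ⟨sandwichRows_constField κ, fun R _ => sandwichRows_constField_pullback κ R⟩

end Summit.QuantumFields.YangMills.Theorems.CurvatureSandwichBound.Negative

end
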